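import Summits.QuantumFields.YangMills.Theorems.BalabanUVNodesN19BirkhoffContractionIntegral
import Summits.QuantumFields.YangMills.Theorems.BalabanUVNodesN19CoreCommonStep

/-!
# BalabanUVNodes ∕ N19 (NE7) — THE SHAPE_cl MEASURE SANDWICH UNDER A STEP COMMON TO BOTH RUNS: any common kernel ∕ map keeps `(c, r)` (data
# processing in the SHAPE currency); a common kernel with a DENSITY of cross-ratio diameter `≤ Δ` CONTRACTS the radius to `tanh(Δ∕4)·r`

Cell `pub-ymgap` (HUMAN RULING D-0062 Track A; D-0149 width seats), seat `pub-ymgap-dag-n19-w2` (WIDTH SEAT 2 of 3 on NODE n19 = NE7), generation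
g6, CLAIM-2 (INBOX l.34667).  Route `Summits/QuantumFields/YangMills/Theses/BalabanUVNodes.lean`, key item K3⁷ `SpineGivenEndpointR13SepCoPH`
(stmt-QuantumFields-20544); filed `--kind proof --supports … --as helper`.  COUNT-NEUTRAL.  THEOREMS ONLY (0 `def`, 0 `sorry`).  ADDITIVE — imports this
seat's g6 `…N19BirkhoffContractionIntegral` (Hopf's integral form: `integral_mul_integral_le_exp_tanh_mul`, `integral_mul_integral_le_exp_dist`) and
`…N19CoreCommonStep` (`logRatio_sub_le_of_mul_le_exp_mul`; through it dag-n19-e `N19CoreMetric.exists_center_of_pairwise_le` and the tree's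
`Spine.NE7.Targets.sandwich_of_abs_log_sub_le`) ONLY; Mathlib `Measure.bind_apply` ∕ `Measure.comp_smul` ∕ `withDensity_mono` ∕ `withDensity_smul'`;
modifies nothing.

THE LETTER.  The class-level SHAPE_cl ∕ NE7-S_cl letter of the lineage (dag-n19-c `N19ClassSandwichRoad`, `N19CoreTVInvariant.tvSandwich_of_shapeSandwich`;
this seat's g4 `…N19TVProductBlocks.shapeSandwich_prod`) compares the two runs' class LAWS `μA`, `μB` on a configuration space by a measure sandwich
`e^{c − r}•μA ≤ μB ≤ e^{c + r}•μA` (`ENNReal.ofReal (Real.exp (c ∓ r)) • μA`); its DENSITY FORM (this seat's g0 `…N19ShapeFaceN14AtRecord`, hypothesis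
`hSh`) is `μB = μA.withDensity ρ` with `e^{c−r} ≤ ρ ≤ e^{c+r}` — Hilbert's projective distance of `μA`, `μB` is `≤ 2r`.  WHAT A COMMON STEP DOES TO IT:
* §1 ★★ `comp_mono_measure` · `shapeSandwich_comp` · `shapeSandwich_map` — ANY kernel `κ` common to both runs (Markov or not) and any common
  measurable map keep the letter with the SAME `(c, r)`: `e^{c−r}•(κ ∘ₘ μA) ≤ κ ∘ₘ μB ≤ e^{c+r}•(κ ∘ₘ μA)`.  The SHAPE twin of this seat's g4 TV data
  processing (`…N19TVKernelChain.abs_comp_real_sub_comp_real_le_base`) and of g6 `…N19CoreCommonStep.core_kernel_of_core`.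
* §2 ★★ `imageDensity_logRatio_sub_le_tanh_mul` — A COMMON KERNEL WITH A DENSITY CONTRACTS: if the step has a density `k x y > 0` against a reference
  on the target whose rows have cross-ratio diameter `≤ Δ` (`k x y·k x′ y′ ≤ e^Δ·k x′ y·k x y′`), then the image densities `F_A y = ∫ k x y dμA(x)`,
  `F_B y = ∫ k x y·ρ x dμA(x)` of the density-form letter at radius `r` satisfy `(log F_B y − log F_A y) − (log F_B y′ − log F_A y′) ≤ tanh(Δ∕4)·2r`
  (Hopf's integral form BY NAME at rows `k · y`, `k · y′`, vectors `1`, `ρ`, distance `2r`) · ★ `imageDensity_logRatio_sub_le` — with merely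
  NON-NEGATIVE `k` the bound is `2r` (weak contraction).
* §3 ★★★ `shapeDensity_image_contract` — THE CONTRACTED LETTER IN DENSITY FORM: `∃ c′, ∀ y, e^{c′ − tanh(Δ∕4)·r}·F_A y ≤ F_B y ≤ e^{c′ + tanh(Δ∕4)·r}·F_A y`
  (midpoint lemma + `sandwich_of_abs_log_sub_le`) — g0's `hSh` shape for the images with radius `tanh(Δ∕4)·r`.
* §4 ★★ `shapeSandwich_withDensity_of_density_bounds` · ★★★ `shapeSandwich_image_contract` — IN MEASURE FORM: the image laws
  `m.withDensity (ofReal ∘ F_A)`, `m.withDensity (ofReal ∘ F_B)` (= `κ ∘ₘ μA`, `κ ∘ₘ μB` when `κ x = m.withDensity (ofReal ∘ k x)`, read definitionally —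
  no kernel object is built here) satisfy the SHAPE_cl measure sandwich at `(c′, tanh(Δ∕4)·r)` (`withDensity_mono`, `withDensity_smul'`).
Hypotheses are EVERYWHERE rather than a.e. (SHAPES; modify on null sets to apply).

HONEST FRAMING.  Count-neutral helper; [folklore]-grade positive-operator ∕ measure theory (Birkhoff 1957 ∕ Hopf 1963; Eveson–Nussbaum 1995 Thm 3.5) on
hypothesis SHAPES produced by nobody: neither run's class laws nor any RG step of [Balaban1988Convergent] ∕ [Balaban1989LargeFieldI ∕ II] is instantiated,
no step is shown to have a density of finite cross-ratio diameter, and realistic diameters are volume-extensive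
(`…N19BirkhoffContractionSharp.crossRatio_le_of_boltzmann`).  NE2–NE7 ∕ NE1′ NOT PRINTED for d = 4 ∕ NOT proved; N19 NOT discharged; K3⁷ OPEN, v5 untouched,
not claimed; counts UNMOVED (typed 28∕28 · discharged 5∕27, A 5∕28); no count claim.  One finite 𝕋⁴ programme at fixed ε, Bałaban AS PRINTED; R4 closes
the conditional finite-𝕋⁴ rung `BalabanLadder.UV` only — the YM mass gap (Clay) is NOT proved by any of this; nothing continuum ∕ ℝ⁴ ∕ OS.  No `def`, no
`instance`, no `sorry`; standard axioms.
-/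

noncomputable section

open MeasureTheory ProbabilityTheory Real
open scoped ENNReal ProbabilityTheory
open Summit.QuantumFields.YangMills.BalabanUVNodes.N19BirkhoffContraction (tanh_quarter_nonneg)
open Summit.QuantumFields.YangMills.BalabanUVNodes.N19BirkhoffContractionIntegral
  (integral_mul_integral_le_exp_tanh_mul integral_mul_integral_le_exp_dist integral_pos_of_pos)
open Summit.QuantumFields.YangMills.BalabanUVNodes.N19CoreCommonStep (logRatio_sub_le_of_mul_le_exp_mul)
open Summit.QuantumFields.YangMills.BalabanUVNodes.N19CoreMetric (exists_center_of_pairwise_le)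
open Summit.QuantumFields.BalabanUV.T4Continuum.Spine.NE7 (sandwich_of_abs_log_sub_le)

namespace Summit.QuantumFields.YangMills.BalabanUVNodes.N19ShapeSandwichCommonStep

/-! ## §1 Any common kernel ∕ map keeps the SHAPE_cl sandwich (data processing in the SHAPE currency) -/

section Monotone

variable {X Y : Type*} [MeasurableSpace X] [MeasurableSpace Y]

/-- composition with a kernel is MONOTONE in the measure: `μ ≤ ν ⇒ κ ∘ₘ μ ≤ κ ∘ₘ ν` (`(κ ∘ₘ μ) s = ∫⁻ κ x s dμ`). [folklore] -/
theorem comp_mono_measure {μ ν : Measure X} (h : μ ≤ ν) (κ : Kernel X Y) : κ ∘ₘ μ ≤ κ ∘ₘ ν := by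
  refine Measure.le_iff.2 fun s hs => ?_
  rw [Measure.bind_apply hs κ.aemeasurable, Measure.bind_apply hs κ.aemeasurable]
  exact lintegral_mono' h le_rfl

/-- **★★ THE SHAPE_cl SANDWICH PASSES ANY COMMON KERNEL** [folklore]: `e^{c−r}•μA ≤ μB ≤ e^{c+r}•μA ⇒ e^{c−r}•(κ ∘ₘ μA) ≤ κ ∘ₘ μB ≤ e^{c+r}•(κ ∘ₘ μA)`
for EVERY kernel `κ` (Markov or not) — same constant, same radius; a step common to both runs is free in the SHAPE currency. -/
theorem shapeSandwich_comp {μA μB : Measure X} {c r : ℝ} (κ : Kernel X Y)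
    (h : ENNReal.ofReal (Real.exp (c - r)) • μA ≤ μB ∧ μB ≤ ENNReal.ofReal (Real.exp (c + r)) • μA) :
    ENNReal.ofReal (Real.exp (c - r)) • (κ ∘ₘ μA) ≤ κ ∘ₘ μB ∧ κ ∘ₘ μB ≤ ENNReal.ofReal (Real.exp (c + r)) • (κ ∘ₘ μA) := by
  constructor
  · rw [← Measure.comp_smul]; exact comp_mono_measure h.1 κ
  · rw [← Measure.comp_smul]; exact comp_mono_measure h.2 κ

/-- … and any common measurable MAP (the deterministic kernel): `μA.map f`, `μB.map f` are sandwiched with the same `(c, r)`. [folklore] -/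
theorem shapeSandwich_map {μA μB : Measure X} {c r : ℝ} {f : X → Y} (hf : Measurable f)
    (h : ENNReal.ofReal (Real.exp (c - r)) • μA ≤ μB ∧ μB ≤ ENNReal.ofReal (Real.exp (c + r)) • μA) :
    ENNReal.ofReal (Real.exp (c - r)) • μA.map f ≤ μB.map f ∧ μB.map f ≤ ENNReal.ofReal (Real.exp (c + r)) • μA.map f := by
  constructor
  · rw [← Measure.map_smul]; exact Measure.map_mono h.1 hf
  · rw [← Measure.map_smul]; exact Measure.map_mono h.2 hf

end Monotone

/-! ## §2 A common kernel with a density of cross-ratio diameter `≤ Δ` contracts the density-form letter -/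

section Density

variable {X Y : Type*} [MeasurableSpace X] {μA : Measure X} [SFinite μA] {k : X → Y → ℝ} {ρ : X → ℝ} {c r Δ : ℝ}

omit [MeasurableSpace X] in
/-- the density-form letter as a Hilbert distance: `e^{c−r} ≤ ρ ≤ e^{c+r}` everywhere ⇒ `ρ x · 1 ≤ e^{2r}·(1 · ρ x′)`. [folklore] -/
theorem rho_mul_le_of_bounds (hρ : ∀ x, Real.exp (c - r) ≤ ρ x ∧ ρ x ≤ Real.exp (c + r)) (x x' : X) :
    ρ x * 1 ≤ Real.exp (2 * r) * (1 * ρ x') := by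
  have h1 := (hρ x).2
  have h2 := (hρ x').1
  have e : Real.exp (c + r) = Real.exp (2 * r) * Real.exp (c - r) := by rw [← Real.exp_add]; ring_nf
  rw [mul_one, one_mul]
  calc ρ x ≤ Real.exp (c + r) := h1
    _ = Real.exp (2 * r) * Real.exp (c - r) := e
    _ ≤ Real.exp (2 * r) * ρ x' := mul_le_mul_of_nonneg_left h2 (Real.exp_pos _).le

/-- **★★ THE IMAGE DENSITIES' LOG-RATIO CONTRACTS BY BIRKHOFF's COEFFICIENT** [folklore] (Hopf 1963; Eveson–Nussbaum 1995 Thm 3.5).  Density-form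
SHAPE letter `e^{c−r} ≤ ρ ≤ e^{c+r}` (`r ≥ 0`) for `μB = μA.withDensity ρ`; a common step with density `k x y > 0` whose rows `x ↦ k x y` have cross-ratio
diameter `≤ Δ` (`k x y·k x′ y′ ≤ e^Δ·k x′ y·k x y′`, `Δ ≥ 0`); `k · y` and `k · y·ρ` integrable.  Then the image densities `F_A y = ∫ k x y dμA`,
`F_B y = ∫ k x y·ρ x dμA` satisfy `F_B y·F_A y′ ≤ e^{tanh(Δ∕4)·2r}·F_A y·F_B y′`. -/
theorem imageDensity_mul_le_exp_tanh_mul (hr : 0 ≤ r) (hΔ : 0 ≤ Δ) (hk : ∀ x y, 0 < k x y)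
    (hρ : ∀ x, Real.exp (c - r) ≤ ρ x ∧ ρ x ≤ Real.exp (c + r))
    (hdiam : ∀ (y y' : Y) (x x' : X), k x y * k x' y' ≤ Real.exp Δ * (k x' y * k x y'))
    (hint : ∀ y, Integrable (fun x => k x y) μA) (hintρ : ∀ y, Integrable (fun x => k x y * ρ x) μA) (y y' : Y) :
    (∫ x, k x y * ρ x ∂μA) * (∫ x, k x y' ∂μA) ≤
      Real.exp (Real.tanh (Δ / 4) * (2 * r)) * ((∫ x, k x y ∂μA) * (∫ x, k x y' * ρ x ∂μA)) := by
  have hρ0 : ∀ x, 0 < ρ x := fun x => lt_of_lt_of_le (Real.exp_pos _) (hρ x).1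
  have h1 : ∀ y, Integrable (fun x => k x y * (1 : ℝ)) μA := fun y => by simpa using hint y
  have h := integral_mul_integral_le_exp_tanh_mul (μ := μA) (a := fun x => k x y) (b := fun x => k x y') (x := fun _ => (1 : ℝ)) (y := ρ)
    (by positivity : (0 : ℝ) ≤ 2 * r) hΔ (fun x => hk x y) (fun x => hk x y') (fun _ => one_pos) hρ0
    (fun x x' => rho_mul_le_of_bounds hρ x x') (fun x x' => hdiam y y' x x') (h1 y) (hintρ y) (h1 y') (hintρ y')
  simpa only [mul_one] using h

/-- **★ WEAK FORM — ANY NON-NEGATIVE DENSITY**: `F_B y·F_A y′ ≤ e^{2r}·F_A y·F_B y′` (the letter's radius never grows). [folklore] -/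
theorem imageDensity_mul_le_exp (hk : ∀ x y, 0 ≤ k x y)
    (hρ : ∀ x, Real.exp (c - r) ≤ ρ x ∧ ρ x ≤ Real.exp (c + r))
    (hint : ∀ y, Integrable (fun x => k x y) μA) (hintρ : ∀ y, Integrable (fun x => k x y * ρ x) μA) (y y' : Y) :
    (∫ x, k x y * ρ x ∂μA) * (∫ x, k x y' ∂μA) ≤ Real.exp (2 * r) * ((∫ x, k x y ∂μA) * (∫ x, k x y' * ρ x ∂μA)) := by
  have h1 : ∀ y, Integrable (fun x => k x y * (1 : ℝ)) μA := fun y => by simpa using hint y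
  have h := integral_mul_integral_le_exp_dist (μ := μA) (a := fun x => k x y) (b := fun x => k x y') (x := fun _ => (1 : ℝ)) (y := ρ)
    (fun x => hk x y) (fun x => hk x y') (fun x x' => rho_mul_le_of_bounds hρ x x') (h1 y) (hintρ y) (h1 y') (hintρ y')
  simpa only [mul_one] using h

/-- **★★ LOG FORM**: on a non-zero `μA`, `(log F_B y − log F_A y) − (log F_B y′ − log F_A y′) ≤ tanh(Δ∕4)·2r`. [folklore] -/
theorem imageDensity_logRatio_sub_le_tanh_mul (hμ : μA ≠ 0) (hr : 0 ≤ r) (hΔ : 0 ≤ Δ) (hk : ∀ x y, 0 < k x y)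
    (hρ : ∀ x, Real.exp (c - r) ≤ ρ x ∧ ρ x ≤ Real.exp (c + r))
    (hdiam : ∀ (y y' : Y) (x x' : X), k x y * k x' y' ≤ Real.exp Δ * (k x' y * k x y'))
    (hint : ∀ y, Integrable (fun x => k x y) μA) (hintρ : ∀ y, Integrable (fun x => k x y * ρ x) μA) (y y' : Y) :
    (Real.log (∫ x, k x y * ρ x ∂μA) - Real.log (∫ x, k x y ∂μA)) -
      (Real.log (∫ x, k x y' * ρ x ∂μA) - Real.log (∫ x, k x y' ∂μA)) ≤ Real.tanh (Δ / 4) * (2 * r) := by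
  have hρ0 : ∀ x, 0 < ρ x := fun x => lt_of_lt_of_le (Real.exp_pos _) (hρ x).1
  have hFA : ∀ y, 0 < ∫ x, k x y ∂μA := fun y => integral_pos_of_pos hμ (fun x => hk x y) (hint y)
  have hFB : ∀ y, 0 < ∫ x, k x y * ρ x ∂μA := fun y => integral_pos_of_pos hμ (fun x => mul_pos (hk x y) (hρ0 x)) (hintρ y)
  exact logRatio_sub_le_of_mul_le_exp_mul (hFA y) (hFB y) (hFA y') (hFB y')
    (imageDensity_mul_le_exp_tanh_mul hr hΔ hk hρ hdiam hint hintρ y y')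

/-- **★ LOG FORM, WEAK**: with merely non-negative `k` (and positive images), `≤ 2r`. [folklore] -/
theorem imageDensity_logRatio_sub_le (hk : ∀ x y, 0 ≤ k x y)
    (hρ : ∀ x, Real.exp (c - r) ≤ ρ x ∧ ρ x ≤ Real.exp (c + r))
    (hint : ∀ y, Integrable (fun x => k x y) μA) (hintρ : ∀ y, Integrable (fun x => k x y * ρ x) μA)
    (hFA : ∀ y, 0 < ∫ x, k x y ∂μA) (hFB : ∀ y, 0 < ∫ x, k x y * ρ x ∂μA) (y y' : Y) :
    (Real.log (∫ x, k x y * ρ x ∂μA) - Real.log (∫ x, k x y ∂μA)) -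
      (Real.log (∫ x, k x y' * ρ x ∂μA) - Real.log (∫ x, k x y' ∂μA)) ≤ 2 * r :=
  logRatio_sub_le_of_mul_le_exp_mul (hFA y) (hFB y) (hFA y') (hFB y') (imageDensity_mul_le_exp hk hρ hint hintρ y y')

/-! ## §3 The contracted letter in DENSITY form (this seat's g0 `hSh` shape for the images) -/

/-- **★★★ THE IMAGE OF A SHAPE LETTER UNDER A COMMON DENSITY KERNEL IS A SHAPE LETTER OF RADIUS `tanh(Δ∕4)·r`** [folklore]: under the hypotheses of
`imageDensity_logRatio_sub_le_tanh_mul` there is ONE constant `c′` with `e^{c′ − tanh(Δ∕4)·r}·F_A y ≤ F_B y ≤ e^{c′ + tanh(Δ∕4)·r}·F_A y` for every `y` —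
the centre of the image log-ratios (dag-n19-e's midpoint lemma) and the tree's `NE7.sandwich_of_abs_log_sub_le`. -/
theorem shapeDensity_image_contract (hμ : μA ≠ 0) (hr : 0 ≤ r) (hΔ : 0 ≤ Δ) (hk : ∀ x y, 0 < k x y)
    (hρ : ∀ x, Real.exp (c - r) ≤ ρ x ∧ ρ x ≤ Real.exp (c + r))
    (hdiam : ∀ (y y' : Y) (x x' : X), k x y * k x' y' ≤ Real.exp Δ * (k x' y * k x y'))
    (hint : ∀ y, Integrable (fun x => k x y) μA) (hintρ : ∀ y, Integrable (fun x => k x y * ρ x) μA) :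
    ∃ c' : ℝ, ∀ y : Y, Real.exp (c' - Real.tanh (Δ / 4) * r) * (∫ x, k x y ∂μA) ≤ ∫ x, k x y * ρ x ∂μA ∧
      ∫ x, k x y * ρ x ∂μA ≤ Real.exp (c' + Real.tanh (Δ / 4) * r) * (∫ x, k x y ∂μA) := by
  have hρ0 : ∀ x, 0 < ρ x := fun x => lt_of_lt_of_le (Real.exp_pos _) (hρ x).1
  have hFA : ∀ y, 0 < ∫ x, k x y ∂μA := fun y => integral_pos_of_pos hμ (fun x => hk x y) (hint y)
  have hFB : ∀ y, 0 < ∫ x, k x y * ρ x ∂μA := fun y => integral_pos_of_pos hμ (fun x => mul_pos (hk x y) (hρ0 x)) (hintρ y)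
  obtain ⟨c', hc'⟩ := exists_center_of_pairwise_le
    (s := {z : ℝ | ∃ y : Y, z = Real.log (∫ x, k x y * ρ x ∂μA) - Real.log (∫ x, k x y ∂μA)}) (η := Real.tanh (Δ / 4) * r) (by
      rintro _ ⟨y, rfl⟩ _ ⟨y', rfl⟩
      have h := imageDensity_logRatio_sub_le_tanh_mul hμ hr hΔ hk hρ hdiam hint hintρ y y'
      linarith)
  exact ⟨c', fun y => sandwich_of_abs_log_sub_le (hFA y) (hFB y) (hc' _ ⟨y, rfl⟩)⟩

/-! ## §4 … and in MEASURE form: the image laws satisfy the SHAPE_cl sandwich at `(c′, tanh(Δ∕4)·r)` -/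

variable [MeasurableSpace Y]

/-- from pointwise density bounds with one constant to the SHAPE_cl measure sandwich of the `withDensity` laws (`withDensity_mono`,
`withDensity_smul'`; no measurability and no sign condition needed — `ENNReal.ofReal` is monotone). [folklore] -/
theorem shapeSandwich_withDensity_of_density_bounds (m : Measure Y) {FA FB : Y → ℝ} {c' r' : ℝ}
    (h : ∀ y, Real.exp (c' - r') * FA y ≤ FB y ∧ FB y ≤ Real.exp (c' + r') * FA y) :
    ENNReal.ofReal (Real.exp (c' - r')) • m.withDensity (fun y => ENNReal.ofReal (FA y)) ≤ m.withDensity (fun y => ENNReal.ofReal (FB y)) ∧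
      m.withDensity (fun y => ENNReal.ofReal (FB y)) ≤
        ENNReal.ofReal (Real.exp (c' + r')) • m.withDensity (fun y => ENNReal.ofReal (FA y)) := by
  constructor
  · rw [← withDensity_smul' _ _ ENNReal.ofReal_ne_top]
    refine withDensity_mono (Filter.Eventually.of_forall fun y => ?_)
    show ENNReal.ofReal (Real.exp (c' - r')) * ENNReal.ofReal (FA y) ≤ ENNReal.ofReal (FB y)
    rw [← ENNReal.ofReal_mul (Real.exp_pos _).le]
    exact ENNReal.ofReal_le_ofReal (h y).1
  · rw [← withDensity_smul' _ _ ENNReal.ofReal_ne_top]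
    refine withDensity_mono (Filter.Eventually.of_forall fun y => ?_)
    show ENNReal.ofReal (FB y) ≤ ENNReal.ofReal (Real.exp (c' + r')) * ENNReal.ofReal (FA y)
    rw [← ENNReal.ofReal_mul (Real.exp_pos _).le]
    exact ENNReal.ofReal_le_ofReal (h y).2

/-- **★★★ THE SHAPE_cl SANDWICH CONTRACTS UNDER A COMMON KERNEL WITH A DENSITY OF DIAMETER `≤ Δ`** [folklore] (Birkhoff 1957 ∕ Hopf 1963, in the lineage's
class-law letters).  Density-form letter `e^{c−r} ≤ ρ ≤ e^{c+r}` for the two runs' class laws (`μB = μA.withDensity ρ`, `μA ≠ 0` s-finite), a common step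
with density `k x y > 0` against a reference `m` on the target whose rows have cross-ratio diameter `≤ Δ`, integrable rows ⇒ the IMAGE laws
`m.withDensity (y ↦ ∫ k x y dμA)` and `m.withDensity (y ↦ ∫ k x y·ρ x dμA)` satisfy the SHAPE_cl measure sandwich with SOME constant `c′` and the
CONTRACTED radius `tanh(Δ∕4)·r`.  (With merely non-negative `k`: radius `r`, §1.) -/
theorem shapeSandwich_image_contract (m : Measure Y) (hμ : μA ≠ 0) (hr : 0 ≤ r) (hΔ : 0 ≤ Δ) (hk : ∀ x y, 0 < k x y)
    (hρ : ∀ x, Real.exp (c - r) ≤ ρ x ∧ ρ x ≤ Real.exp (c + r))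
    (hdiam : ∀ (y y' : Y) (x x' : X), k x y * k x' y' ≤ Real.exp Δ * (k x' y * k x y'))
    (hint : ∀ y, Integrable (fun x => k x y) μA) (hintρ : ∀ y, Integrable (fun x => k x y * ρ x) μA) :
    ∃ c' : ℝ, ENNReal.ofReal (Real.exp (c' - Real.tanh (Δ / 4) * r)) • m.withDensity (fun y => ENNReal.ofReal (∫ x, k x y ∂μA)) ≤
        m.withDensity (fun y => ENNReal.ofReal (∫ x, k x y * ρ x ∂μA)) ∧
      m.withDensity (fun y => ENNReal.ofReal (∫ x, k x y * ρ x ∂μA)) ≤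
        ENNReal.ofReal (Real.exp (c' + Real.tanh (Δ / 4) * r)) • m.withDensity (fun y => ENNReal.ofReal (∫ x, k x y ∂μA)) := by
  obtain ⟨c', hc'⟩ := shapeDensity_image_contract hμ hr hΔ hk hρ hdiam hint hintρ
  exact ⟨c', shapeSandwich_withDensity_of_density_bounds m hc'⟩

end Density

end Summit.QuantumFields.YangMills.BalabanUVNodes.N19ShapeSandwichCommonStep

end
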